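import Summits.Ventures.LatticeQCDFlow.Scaling.SimulatedTemperingLevelWalk
import Summits.Ventures.LatticeQCDFlow.Scaling.ParallelTemperingExactLevelLaw

/-!
HONEST FRAMING: exact (Metropolis-corrected) sampling algorithms for lattice gauge theory; figures
of merit are autocorrelation/cost numbers at stated couplings and volumes; no continuum-physics
claim.

# ParallelTemperingTagWalk — UNDER PERFECT REPLICA UPDATES THE TAGGED REPLICA OF THE REPLICA-EXCHANGE SAMPLER IS
# EXACTLY A BIRTH–DEATH CHAIN WITH RATES `swapAcc/K` PER SWAP ATTEMPT; WITH UNIFORM SWAP ACCEPTANCE `a` IT IS ROW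
# 22's `ladderWalk K (2a/K)`, DELIVERY TIME `K²(K+1)/(2a)` ATTEMPTS (lean-2 GEN-14, ours; the PTBC side of the bridge)

Venture-side (OURS).  Cell `lqcd-flow` (pub-lqcd), unit `pub-lqcd-lean-2-g14`, 2026-08-24.  The replica-exchange
counterpart of `Scaling/SimulatedTemperingLevelWalk`: row 22's idealised label walk for PTBC
(`Scaling/SwapLadderDeliveryTime`: the tracked configuration moves up / down one rung with probability `a/2` per
round) is EXACT for GEN-14's constructed sampler when the replicas are redrawn independently from their own
level laws between swap attempts (`ptPerfectSweep = stWithinLevel (_ ↦ const (⊗_k μ_{β_k}))`, the ideal of a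
perfect trivializing flow at every coupling): the one-step law of the tag of `ptSwapKernel ∘ₖ ptPerfectSweep` is
a function of the tag alone and equals `bdKernel K p q` with `p_τ = swapAcc(β_τ, β_{τ+1})/K` (`τ < K`),
`q_τ = swapAcc(β_{τ−1}, β_τ)/K` (`τ ≥ 1`) — one ATTEMPT picks one of the `K` pairs.  With uniform swap acceptance
`a` this is `ladderWalk K (2a/K)`, so row 22's delivery time reads `E_0(τ_K) = K(K+1)/(2a/K) = K²(K+1)/(2a)` swap
attempts, i.e. `K(K+1)/a` of row 22's rounds at `K/2` attempts per round.

## What is defined / proved (`μ` probability, `X` bounded measurable, `K ≥ 1` where stated)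

* `ptLadderUp`, `ptLadderDown`, **`ptLevelWalk X μ β K = bdKernel K ptLadderUp ptLadderDown`**; `ptPerfectSweep`
  (Markov, tag-preserving, `ptTaggedTarget`-invariant and -reversible: `isMarkovKernel_ptPerfectSweep`, `ptPerfectSweep_tagPreserving`, `invariant_ptPerfectSweep`, `isReversible_ptPerfectSweep`).
* `sum_ite_castSucc_eq`, `sum_ite_succ_eq` (Fin bookkeeping); `integral_ptSwapRatio_level`;
  `ptSwapKernel_real_up`, `ptSwapKernel_real_down`, `ptSwapKernel_real_self`, `ptSwapKernel_real_far`;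
  `ptPerfect_comp_real`.
* **`ptPerfect_tagKernel_eq_walk`** — `((S ∘ₖ W_perfect)(τ, x)).real {tag = τ'} = ptLevelWalk X μ β K τ τ'`.
* **`ptLevelWalk_eq_ladderWalk`** — uniform `swapAcc(β_j, β_{j+1}) = a` (`j < K`) ⇒ `ptLevelWalk = ladderWalk K (2a/K)`;
  **`ptPerfect_delivery_time`** — then a hitting-time solution with `E_0(τ_K) = K(K+1)/(2a/K)` exists
  (`0 < a`, `2a/K ≤ 1`).

NOT CLAIMED: trajectory-level identification of hitting times (lumpability, matrix-side in the tree);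
non-perfect replica updates; half-sweeps; anything measured.  Literature grade (cell rule): KNOWN MECHANISM, NEW
TYPING (kernel-exact identification of the PTBC idealisation); nothing cited as a fact.
-/

noncomputable section

open MeasureTheory ProbabilityTheory Set Filter Finset
open Summit.Ventures.LatticeQCDFlow.Scoring
open Literature.Probability.MarkovChains
open scoped ENNReal

namespace Summit.Ventures.LatticeQCDFlow.Scaling

section Walk
variable {Ω : Type*} [MeasurableSpace Ω]

/-- Up-rates of the lumped tag walk per swap attempt: `swapAcc(β_τ, β_{τ+1})/K` below the top. [ours] -/
def ptLadderUp (X : Ω → ℝ) (μ : Measure Ω) (β : ℕ → ℝ) (K : ℕ) (k : ℕ) : ℝ :=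
  if k < K then swapAcc X μ (β k) (β (k + 1)) / K else 0

/-- Down-rates: `swapAcc(β_{τ−1}, β_τ)/K` above the bottom. [ours] -/
def ptLadderDown (X : Ω → ℝ) (μ : Measure Ω) (β : ℕ → ℝ) (K : ℕ) (k : ℕ) : ℝ :=
  if k = 0 then 0 else swapAcc X μ (β (k - 1)) (β k) / K

/-- **The lumped tag walk** (the Literature's `bdKernel`). [ours] -/
def ptLevelWalk (X : Ω → ℝ) (μ : Measure Ω) (β : ℕ → ℝ) (K : ℕ) : Matrix (Fin (K + 1)) (Fin (K + 1)) ℝ :=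
  bdKernel K (ptLadderUp X μ β K) (ptLadderDown X μ β K)

/-- **Perfect replica updates**: redraw ALL replicas independently from their level laws, keep the tag. [ours] -/
def ptPerfectSweep (X : Ω → ℝ) (μ : Measure Ω) (β : ℕ → ℝ) (K : ℕ) :
    Kernel (Fin (K + 1) × (Fin (K + 1) → Ω)) (Fin (K + 1) × (Fin (K + 1) → Ω)) :=
  stWithinLevel fun _ : Fin (K + 1) => Kernel.const (Fin (K + 1) → Ω)
    (Measure.pi fun k : Fin (K + 1) => μ.tilted fun x => β k * X x)

variable {X : Ω → ℝ} {μ : Measure Ω} {β : ℕ → ℝ} {K : ℕ}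

/-- Fin bookkeeping: `Σ_{j<K} 1[castSucc j = τ]·g(j) = 1[τ < K]·g(τ)`. [folklore] -/
theorem sum_ite_castSucc_eq (g : ℕ → ℝ) (τ : Fin (K + 1)) :
    (∑ j : Fin K, if Fin.castSucc j = τ then g j else 0) = if (τ : ℕ) < K then g τ else 0 := by
  by_cases hτ : (τ : ℕ) < K
  · rw [if_pos hτ, Finset.sum_eq_single ⟨τ, hτ⟩]
    · rw [if_pos (Fin.ext (by simp))]
    · intro j _ hj
      rw [if_neg]
      intro h; apply hj; ext; have := congrArg Fin.val h; simpa using this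
    · intro h; exact absurd (Finset.mem_univ _) h
  · rw [if_neg hτ]
    refine Finset.sum_eq_zero fun j _ => ?_
    rw [if_neg]
    intro h; apply hτ; have := congrArg Fin.val h; simp at this; omega

/-- Fin bookkeeping: `Σ_{j<K} 1[succ j = τ]·g(j) = 1[1 ≤ τ]·g(τ−1)`. [folklore] -/
theorem sum_ite_succ_eq (g : ℕ → ℝ) (τ : Fin (K + 1)) :
    (∑ j : Fin K, if Fin.succ j = τ then g j else 0) = if 1 ≤ (τ : ℕ) then g ((τ : ℕ) - 1) else 0 := by
  by_cases hτ : 1 ≤ (τ : ℕ)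
  · have hlt : (τ : ℕ) - 1 < K := by have := τ.isLt; omega
    rw [if_pos hτ, Finset.sum_eq_single ⟨(τ : ℕ) - 1, hlt⟩]
    · rw [if_pos (Fin.ext (by simp; omega))]
    · intro j _ hj
      rw [if_neg]
      intro h; apply hj; ext; have := congrArg Fin.val h; simp at this; simp; omega
    · intro h; exact absurd (Finset.mem_univ _) h
  · rw [if_neg hτ]
    refine Finset.sum_eq_zero fun j _ => ?_
    rw [if_neg]
    intro h; apply hτ; have := congrArg Fin.val h; simp at this; omega

variable [IsProbabilityMeasure μ]

/-- `∫ ptSwapRatio(τ, x) d(⊗μ_{β_k})(x) = Σ_j ptTagCoef(j, τ)·swapAcc(β_j, β_{j+1})` (the per-tag step of GEN-13's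
`pt_moveRate_eq`). [ours] -/
theorem integral_ptSwapRatio_level (hXm : Measurable X) (hXb : ∃ C, ∀ x, |X x| ≤ C) (τ : Fin (K + 1)) :
    ∫ x, ptSwapRatio X β K (τ, x) ∂(Measure.pi fun k : Fin (K + 1) => μ.tilted fun x => β k * X x) =
      ∑ j : Fin K, ptTagCoef K j τ * swapAcc X μ (β (j : ℕ)) (β ((j : ℕ) + 1)) := by
  haveI := isProbabilityMeasure_pi_tilted (μ := μ) (β := β) (K := K) hXm hXb
  have hi : ∀ j : Fin K, Integrable (ptPairRatio X β K j)
      (Measure.pi fun k : Fin (K + 1) => μ.tilted fun x => β k * X x) := fun j =>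
    Integrable.of_bound (measurable_ptPairRatio (β := β) hXm j).aestronglyMeasurable 1
      (ae_of_all _ fun x => by
        rw [Real.norm_eq_abs, abs_of_nonneg (ptPairRatio_mem j x).1]; exact (ptPairRatio_mem j x).2)
  unfold ptSwapRatio
  dsimp only
  rw [integral_finsetSum _ fun j _ => (hi j).const_mul _]
  refine Finset.sum_congr rfl fun j _ => ?_
  rw [MeasureTheory.integral_const_mul, integral_ptPairRatio_eq_swapAcc hXm hXb j]

/-- The perfect sweep is Markov (`μ` probability, `X` bounded measurable). [ours] -/
theorem isMarkovKernel_ptPerfectSweep (hXm : Measurable X) (hXb : ∃ C, ∀ x, |X x| ≤ C) :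
    IsMarkovKernel (ptPerfectSweep X μ β K) := by
  haveI := isProbabilityMeasure_pi_tilted (μ := μ) (β := β) (K := K) hXm hXb
  unfold ptPerfectSweep; infer_instance

omit [IsProbabilityMeasure μ] in
/-- **It preserves the tag.** [ours] -/
theorem ptPerfectSweep_tagPreserving (y : Fin (K + 1) × (Fin (K + 1) → Ω)) :
    ptPerfectSweep X μ β K y {y' | ((y'.1 : Fin (K + 1)) : ℕ) ≠ ((y.1 : Fin (K + 1)) : ℕ)} = 0 :=
  stWithinLevel_levelPreserving _ y

/-- **It leaves the tagged target invariant.** [ours] -/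
theorem invariant_ptPerfectSweep (hXm : Measurable X) (hXb : ∃ C, ∀ x, |X x| ≤ C) :
    Kernel.Invariant (ptPerfectSweep X μ β K) (ptTaggedTarget X μ β K) := by
  haveI := isProbabilityMeasure_pi_tilted (μ := μ) (β := β) (K := K) hXm hXb
  have hPi := invariant_kernelConst (π := Measure.pi fun i : Fin (K + 1) => μ.tilted fun x => β i * X x)
  unfold Kernel.Invariant
  ext A hA
  rw [Measure.bind_apply hA (Kernel.aemeasurable _),
    lintegral_ptTaggedTarget ((ptPerfectSweep X μ β K).measurable_coe hA)]
  have h : ∀ τ : Fin (K + 1), ∫⁻ x, ptPerfectSweep X μ β K (τ, x) A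
      ∂(Measure.pi fun i : Fin (K + 1) => μ.tilted fun x => β i * X x) =
      (Measure.pi fun i : Fin (K + 1) => μ.tilted fun x => β i * X x) (Prod.mk τ ⁻¹' A) := by
    intro τ
    simp only [ptPerfectSweep, stWithinLevel_apply' _ _ hA]
    rw [← Measure.bind_apply (measurable_prodMk_left hA) (Kernel.aemeasurable _)]
    exact congrFun (congrArg DFunLike.coe hPi.def) _
  simp only [h]
  simp only [ptTaggedTarget, Measure.smul_apply, Measure.coe_finsetSum, Finset.sum_apply,
    Measure.map_apply measurable_prodMk_left hA, smul_eq_mul]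

omit [IsProbabilityMeasure μ] in
/-- **It is reversible** for the tagged target. [ours] -/
theorem isReversible_ptPerfectSweep :
    Kernel.IsReversible (ptPerfectSweep X μ β K) (ptTaggedTarget X μ β K) := by
  have hPi := isReversible_kernelConst (π := Measure.pi fun i : Fin (K + 1) => μ.tilted fun x => β i * X x)
  intro A B hA hB
  rw [setLIntegral_ptTaggedTarget_level ((ptPerfectSweep X μ β K).measurable_coe hB) hA,
    setLIntegral_ptTaggedTarget_level ((ptPerfectSweep X μ β K).measurable_coe hA) hB]
  congr 1
  refine Finset.sum_congr rfl fun τ _ => ?_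
  simp only [ptPerfectSweep, stWithinLevel_apply' _ _ hB, stWithinLevel_apply' _ _ hA]
  exact hPi (measurable_prodMk_left hA) (measurable_prodMk_left hB)

omit [IsProbabilityMeasure μ] in
/-- One rung up: `S(τ, x){tag = τ+1} = r_τ(x)/K` (`τ < K`). [ours] -/
theorem ptSwapKernel_real_up (hXm : Measurable X) (τ : Fin (K + 1)) (x : Fin (K + 1) → Ω) (hτ : (τ : ℕ) < K) :
    (ptSwapKernel hXm β K (τ, x)).real {y | ((y.1 : Fin (K + 1)) : ℕ) = (τ : ℕ) + 1} =
      ptPairRatio X β K ⟨τ, hτ⟩ x / K := by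
  set T : Set (Fin (K + 1) × (Fin (K + 1) → Ω)) := {y | ((y.1 : Fin (K + 1)) : ℕ) = (τ : ℕ) + 1} with hT_def
  have hT : MeasurableSet T := measurable_ptLevel (measurableSet_singleton _)
  rw [measureReal_def, ptSwapKernel_apply' hXm _ hT]
  have hz : ((τ, x) : Fin (K + 1) × (Fin (K + 1) → Ω)) ∉ T := by simp [hT_def]
  have hsw : ∀ j : Fin K, T.indicator (1 : Fin (K + 1) × (Fin (K + 1) → Ω) → ℝ≥0∞) (ptSwapMap K j (τ, x)) =
      if Fin.castSucc j = τ then 1 else 0 := by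
    intro j
    by_cases h : Fin.castSucc j = τ
    · rw [if_pos h, Set.indicator_of_mem]
      · rfl
      · show ((ptPerm K j τ : Fin (K + 1)) : ℕ) = (τ : ℕ) + 1
        rw [← h, ptPerm_castSucc]; simp
    · rw [if_neg h, Set.indicator_of_notMem]
      show ¬ ((ptPerm K j τ : Fin (K + 1)) : ℕ) = (τ : ℕ) + 1
      unfold ptPerm
      rw [Equiv.swap_apply_def]
      split_ifs with h1 h2
      · exact absurd h1.symm h
      · subst h2; simp only [Fin.val_castSucc, Fin.val_succ]; omega
      · simp
  simp only [hsw, Set.indicator_of_notMem hz, mul_zero, add_zero]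
  have hsum : (∑ j : Fin K, ENNReal.ofReal (ptPairRatio X β K j x) * (if Fin.castSucc j = τ then 1 else 0)) =
      ENNReal.ofReal (ptPairRatio X β K ⟨τ, hτ⟩ x) := by
    rw [Finset.sum_eq_single ⟨τ, hτ⟩]
    · rw [if_pos (Fin.ext (by simp)), mul_one]
    · intro j _ hj
      rw [if_neg, mul_zero]
      intro h; apply hj; ext; have := congrArg Fin.val h; simpa using this
    · intro h; exact absurd (Finset.mem_univ _) h
  rw [hsum, ENNReal.toReal_mul, ENNReal.toReal_inv, ENNReal.toReal_natCast,
    ENNReal.toReal_ofReal (ptPairRatio_mem _ x).1, inv_mul_eq_div]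

omit [IsProbabilityMeasure μ] in
/-- One rung down: `S(τ, x){tag + 1 = τ} = r_{τ−1}(x)/K` (`τ ≥ 1`). [ours] -/
theorem ptSwapKernel_real_down (hXm : Measurable X) (τ : Fin (K + 1)) (x : Fin (K + 1) → Ω)
    (hτ : 1 ≤ (τ : ℕ)) :
    (ptSwapKernel hXm β K (τ, x)).real {y | ((y.1 : Fin (K + 1)) : ℕ) + 1 = (τ : ℕ)} =
      ptPairRatio X β K ⟨(τ : ℕ) - 1, by have := τ.isLt; omega⟩ x / K := by
  have hlt : (τ : ℕ) - 1 < K := by have := τ.isLt; omega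
  set T : Set (Fin (K + 1) × (Fin (K + 1) → Ω)) := {y | ((y.1 : Fin (K + 1)) : ℕ) + 1 = (τ : ℕ)} with hT_def
  have e : T = (fun y : Fin (K + 1) × (Fin (K + 1) → Ω) => ((y.1 : Fin (K + 1)) : ℕ)) ⁻¹' {n : ℕ | n + 1 = (τ : ℕ)} := by
    ext y; simp [hT_def]
  have hT : MeasurableSet T := by rw [e]; exact measurable_ptLevel MeasurableSet.of_discrete
  rw [measureReal_def, ptSwapKernel_apply' hXm _ hT]
  have hz : ((τ, x) : Fin (K + 1) × (Fin (K + 1) → Ω)) ∉ T := by simp [hT_def]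
  have hsw : ∀ j : Fin K, T.indicator (1 : Fin (K + 1) × (Fin (K + 1) → Ω) → ℝ≥0∞) (ptSwapMap K j (τ, x)) =
      if Fin.succ j = τ then 1 else 0 := by
    intro j
    by_cases h : Fin.succ j = τ
    · rw [if_pos h, Set.indicator_of_mem]
      · rfl
      · show ((ptPerm K j τ : Fin (K + 1)) : ℕ) + 1 = (τ : ℕ)
        rw [← h, ptPerm_succ]; simp
    · rw [if_neg h, Set.indicator_of_notMem]
      show ¬ (((ptPerm K j τ : Fin (K + 1)) : ℕ) + 1 = (τ : ℕ))
      unfold ptPerm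
      rw [Equiv.swap_apply_def]
      split_ifs with h1 h2
      · subst h1; simp only [Fin.val_castSucc, Fin.val_succ]; omega
      · exact absurd h2.symm h
      · simp
  simp only [hsw, Set.indicator_of_notMem hz, mul_zero, add_zero]
  have hsum : (∑ j : Fin K, ENNReal.ofReal (ptPairRatio X β K j x) * (if Fin.succ j = τ then 1 else 0)) =
      ENNReal.ofReal (ptPairRatio X β K ⟨(τ : ℕ) - 1, hlt⟩ x) := by
    rw [Finset.sum_eq_single ⟨(τ : ℕ) - 1, hlt⟩]
    · rw [if_pos (Fin.ext (by simp; omega)), mul_one]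
    · intro j _ hj
      rw [if_neg, mul_zero]
      intro h; apply hj; ext; have := congrArg Fin.val h; simp at this; simp; omega
    · intro h; exact absurd (Finset.mem_univ _) h
  rw [hsum, ENNReal.toReal_mul, ENNReal.toReal_inv, ENNReal.toReal_natCast,
    ENNReal.toReal_ofReal (ptPairRatio_mem _ x).1, inv_mul_eq_div]

omit [IsProbabilityMeasure μ] in
/-- Stay: `S(z){tag = tag z} = 1 − ptSwapRatio(z)/K` (complement of GEN-14's `ptSwapKernel_real_moves_eq`). [ours] -/
theorem ptSwapKernel_real_self (hXm : Measurable X) [NeZero K] (z : Fin (K + 1) × (Fin (K + 1) → Ω)) :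
    (ptSwapKernel hXm β K z).real {y | ((y.1 : Fin (K + 1)) : ℕ) = ((z.1 : Fin (K + 1)) : ℕ)} =
      1 - ptSwapRatio X β K z / K := by
  have hS : MeasurableSet {y : Fin (K + 1) × (Fin (K + 1) → Ω) | ((y.1 : Fin (K + 1)) : ℕ) ≠ ((z.1 : Fin (K + 1)) : ℕ)} := by
    have e : {y : Fin (K + 1) × (Fin (K + 1) → Ω) | ((y.1 : Fin (K + 1)) : ℕ) ≠ ((z.1 : Fin (K + 1)) : ℕ)} =
        (fun y : Fin (K + 1) × (Fin (K + 1) → Ω) => ((y.1 : Fin (K + 1)) : ℕ)) ⁻¹' {n : ℕ | n ≠ ((z.1 : Fin (K + 1)) : ℕ)} := by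
      ext y; simp
    rw [e]; exact measurable_ptLevel MeasurableSet.of_discrete
  have e : {y : Fin (K + 1) × (Fin (K + 1) → Ω) | ((y.1 : Fin (K + 1)) : ℕ) = ((z.1 : Fin (K + 1)) : ℕ)} =
      {y : Fin (K + 1) × (Fin (K + 1) → Ω) | ((y.1 : Fin (K + 1)) : ℕ) ≠ ((z.1 : Fin (K + 1)) : ℕ)}ᶜ := by
    ext y; simp
  rw [e, measureReal_compl hS, probReal_univ, ptSwapKernel_real_moves_eq hXm z]

omit [IsProbabilityMeasure μ] in
/-- Far: `S(τ, x){tag = τ'} = 0` when `τ'` is two or more rungs from `τ`. [ours] -/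
theorem ptSwapKernel_real_far (hXm : Measurable X) (τ τ' : Fin (K + 1)) (x : Fin (K + 1) → Ω)
    (h1 : (τ' : ℕ) ≠ τ + 1) (h2 : (τ : ℕ) ≠ τ' + 1) (h3 : τ ≠ τ') :
    (ptSwapKernel hXm β K (τ, x)).real {y | ((y.1 : Fin (K + 1)) : ℕ) = (τ' : ℕ)} = 0 := by
  have hkk : (τ : ℕ) ≠ τ' := fun h => h3 (Fin.ext h)
  have hsub : {y : Fin (K + 1) × (Fin (K + 1) → Ω) | ((y.1 : Fin (K + 1)) : ℕ) = (τ' : ℕ)} ⊆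
      {y | ¬ |(((y.1 : Fin (K + 1)) : ℕ) : ℝ) - (((τ, x) : Fin (K + 1) × (Fin (K + 1) → Ω)).1 : ℕ)| ≤ 1} := by
    intro y hy
    simp only [Set.mem_setOf_eq] at hy ⊢
    rw [hy, abs_le]
    rintro ⟨ha, hb⟩
    have ha' : ((τ : ℕ) : ℝ) ≤ (τ' : ℕ) + 1 := by linarith
    have hb' : ((τ' : ℕ) : ℝ) ≤ (τ : ℕ) + 1 := by linarith
    have ha'' : (τ : ℕ) ≤ (τ' : ℕ) + 1 := by exact_mod_cast ha'
    have hb'' : (τ' : ℕ) ≤ (τ : ℕ) + 1 := by exact_mod_cast hb'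
    omega
  rw [measureReal_def, measure_mono_null hsub (ae_iff.1 (ptSwapKernel_nearestNeighbour hXm (β := β) (τ, x))),
    ENNReal.toReal_zero]

omit [IsProbabilityMeasure μ] in
/-- `(S ∘ₖ W_perfect)(τ, x)(T) = ∫ S(τ, x')(T) d(⊗μ_{β_k})(x')`. [ours] -/
theorem ptPerfect_comp_real (hXm : Measurable X) [NeZero K] (τ : Fin (K + 1)) (x : Fin (K + 1) → Ω)
    {T : Set (Fin (K + 1) × (Fin (K + 1) → Ω))} (hT : MeasurableSet T) :
    ((ptSwapKernel hXm β K ∘ₖ ptPerfectSweep X μ β K) (τ, x)).real T =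
      ∫ x', (ptSwapKernel hXm β K (τ, x')).real T ∂(Measure.pi fun k : Fin (K + 1) => μ.tilted fun x => β k * X x) := by
  rw [measureReal_def, Kernel.comp_apply' _ _ _ hT]
  unfold ptPerfectSweep
  rw [lintegral_stWithinLevel _ ((ptSwapKernel hXm β K).measurable_coe hT), Kernel.const_apply]
  dsimp only
  simp only [measureReal_def]
  have hf : Measurable fun x' : Fin (K + 1) → Ω => ptSwapKernel hXm β K (τ, x') T :=
    ((ptSwapKernel hXm β K).measurable_coe hT).comp measurable_prodMk_left
  rw [integral_toReal hf.aemeasurable (ae_of_all _ fun x' => measure_lt_top _ _)]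

/-- **THE TAG OF THE PERFECTLY-SWEPT REPLICA-EXCHANGE SAMPLER IS THE LUMPED BIRTH–DEATH WALK**: for all `τ, τ'`
and every replica configuration `x`, `((S ∘ₖ W_perfect)(τ, x)).real {tag = τ'} = ptLevelWalk X μ β K τ τ'`
(`K ≥ 1`). [ours] -/
theorem ptPerfect_tagKernel_eq_walk (hXm : Measurable X) (hXb : ∃ C, ∀ x, |X x| ≤ C) (hK : 1 ≤ K)
    (τ τ' : Fin (K + 1)) (x : Fin (K + 1) → Ω) :
    ((ptSwapKernel hXm β K ∘ₖ ptPerfectSweep X μ β K) (τ, x)).real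
        {y | ((y.1 : Fin (K + 1)) : ℕ) = (τ' : ℕ)} = ptLevelWalk X μ β K τ τ' := by
  haveI := isProbabilityMeasure_pi_tilted (μ := μ) (β := β) (K := K) hXm hXb
  haveI : NeZero K := ⟨by omega⟩
  have hK0 : (0 : ℝ) < K := by exact_mod_cast hK
  have hT : MeasurableSet {y : Fin (K + 1) × (Fin (K + 1) → Ω) | ((y.1 : Fin (K + 1)) : ℕ) = (τ' : ℕ)} :=
    measurable_ptLevel (measurableSet_singleton _)
  have hi : ∀ j : Fin K, Integrable (ptPairRatio X β K j)
      (Measure.pi fun k : Fin (K + 1) => μ.tilted fun x => β k * X x) := fun j =>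
    Integrable.of_bound (measurable_ptPairRatio (β := β) hXm j).aestronglyMeasurable 1
      (ae_of_all _ fun x => by
        rw [Real.norm_eq_abs, abs_of_nonneg (ptPairRatio_mem j x).1]; exact (ptPairRatio_mem j x).2)
  rw [ptPerfect_comp_real hXm τ x hT]
  unfold ptLevelWalk
  by_cases h1 : (τ' : ℕ) = τ + 1
  · have hτ : (τ : ℕ) < K := by have := τ'.isLt; omega
    simp only [h1, ptSwapKernel_real_up hXm τ _ hτ]
    rw [integral_div, integral_ptPairRatio_eq_swapAcc hXm hXb, bdKernel_apply_succ h1]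
    unfold ptLadderUp; rw [if_pos hτ]
  by_cases h2 : (τ : ℕ) = τ' + 1
  · have hτ : 1 ≤ (τ : ℕ) := by omega
    have e : ∀ x', (ptSwapKernel hXm β K (τ, x')).real {y | ((y.1 : Fin (K + 1)) : ℕ) = (τ' : ℕ)} =
        (ptSwapKernel hXm β K (τ, x')).real {y | ((y.1 : Fin (K + 1)) : ℕ) + 1 = (τ : ℕ)} := by
      intro x'
      have hset : {y : Fin (K + 1) × (Fin (K + 1) → Ω) | ((y.1 : Fin (K + 1)) : ℕ) = (τ' : ℕ)} =
          {y | ((y.1 : Fin (K + 1)) : ℕ) + 1 = (τ : ℕ)} := by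
        ext y; simp only [Set.mem_setOf_eq]; omega
      rw [hset]
    simp only [e, ptSwapKernel_real_down hXm τ _ hτ]
    rw [integral_div, integral_ptPairRatio_eq_swapAcc hXm hXb, bdKernel_apply_pred h2]
    unfold ptLadderDown
    rw [if_neg (by omega)]
    simp only [Nat.sub_add_cancel hτ]
  by_cases h3 : τ = τ'
  · subst h3
    simp only [ptSwapKernel_real_self hXm]
    have hsr : Integrable (fun x' => ptSwapRatio X β K (τ, x'))
        (Measure.pi fun k : Fin (K + 1) => μ.tilted fun x => β k * X x) :=
      Integrable.of_bound ((measurable_ptSwapRatio (β := β) hXm).comp measurable_prodMk_left).aestronglyMeasurable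
        (2 * K) (ae_of_all _ fun x' => by
          rw [Real.norm_eq_abs, abs_of_nonneg (ptSwapRatio_nonneg _)]; exact ptSwapRatio_le _)
    rw [integral_sub (integrable_const 1) (hsr.div_const _), integral_const, probReal_univ, one_smul,
      integral_div, integral_ptSwapRatio_level hXm hXb, bdKernel_apply_self]
    -- `Σ_j coef_j(τ)·acc_j = 1[τ<K]·acc_τ + 1[τ≥1]·acc_{τ−1}`
    unfold ptTagCoef ptLadderUp ptLadderDown
    simp only [add_mul, ite_mul, one_mul, zero_mul, Finset.sum_add_distrib]
    rw [sum_ite_castSucc_eq (fun n => swapAcc X μ (β n) (β (n + 1))) τ,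
      sum_ite_succ_eq (fun n => swapAcc X μ (β n) (β (n + 1))) τ]
    by_cases hA : (τ : ℕ) < K <;> by_cases hB : 1 ≤ (τ : ℕ)
    · have hC : (τ : ℕ) ≠ 0 := by omega
      simp only [if_pos hA, if_pos hB, if_neg hC, Nat.sub_add_cancel hB]; ring
    · have hC : (τ : ℕ) = 0 := by omega
      simp only [if_pos hA, if_neg hB, if_pos hC]; ring
    · have hC : (τ : ℕ) ≠ 0 := by omega
      simp only [if_neg hA, if_pos hB, if_neg hC, Nat.sub_add_cancel hB]; ring
    · have hC : (τ : ℕ) = 0 := by omega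
      simp only [if_neg hA, if_neg hB, if_pos hC]; ring
  · simp only [ptSwapKernel_real_far hXm τ τ' _ h1 h2 h3, integral_zero]
    rw [bdKernel_apply_of_ne h1 h2 h3]

omit [IsProbabilityMeasure μ] in
/-- Uniform swap acceptance `a` along the ladder ⇒ the lumped tag walk IS row 22's `ladderWalk K (2a/K)`
(`a/K = (2a/K)/2` per attempt and side). [ours] -/
theorem ptLevelWalk_eq_ladderWalk {a : ℝ} (h : ∀ j, j < K → swapAcc X μ (β j) (β (j + 1)) = a) :
    ptLevelWalk X μ β K = ladderWalk K (2 * a / K) := by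
  unfold ptLevelWalk ladderWalk
  have hu : ptLadderUp X μ β K = ladderUp K (2 * a / K) := by
    funext j; unfold ptLadderUp ladderUp
    split_ifs with hj
    · rw [h j hj]; ring
    · rfl
  have hd : ∀ j, j ≤ K → ptLadderDown X μ β K j = ladderDown (2 * a / K) j := by
    intro j hj; unfold ptLadderDown ladderDown
    split_ifs with hj0
    · rfl
    · have h' := h (j - 1) (by omega)
      rw [show j - 1 + 1 = j by omega] at h'
      rw [h']; ring
  rw [hu]
  ext i j
  simp only [bdKernel, Matrix.of_apply, hd i i.is_le]

omit [IsProbabilityMeasure μ] in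
/-- **DELIVERY TIME, EXACTLY (PTBC side)**: under perfect replica updates on a ladder with uniform swap acceptance
`a > 0` (`2a/K ≤ 1`, `K ≥ 1`), the tag walk of the replica-exchange sampler has a hitting-time solution with
`E_0(τ_K) = K(K+1)/(2a/K)` swap attempts (row 22's `ladder_delivery_time'`). [ours] -/
theorem ptPerfect_delivery_time {a : ℝ} (ha0 : 0 < a) (haK : 2 * a / K ≤ 1) (hK : 1 ≤ K)
    (h : ∀ j, j < K → swapAcc X μ (β j) (β (j + 1)) = a) :
    ∃ hit : Fin (K + 1) → Fin (K + 1) → ℝ, IsHittingTimeSolution (ptLevelWalk X μ β K) hit ∧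
      hit 0 (Fin.last K) = (K : ℝ) * (K + 1) / (2 * a / K) := by
  rw [ptLevelWalk_eq_ladderWalk h]
  have hK0 : (0 : ℝ) < K := by exact_mod_cast hK
  exact ladder_delivery_time' K (by positivity) haK

end Walk

end Summit.Ventures.LatticeQCDFlow.Scaling

end
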